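import Literature.AlgebraicGeometry.GroupSchemes.StrictBirationalGroupLaw
import Mathlib.CategoryTheory.MorphismProperty.Limits
import HarnessLib

/-!
# The shears of Artin's chart `(a, b) ↦ x⁻¹((xa)b)` are open immersions
# (Artin, *Néron models*, §2, Lemma 2.3 / (2.5): the maximal law is again a birational group law)

Topic `Literature/AlgebraicGeometry/GroupSchemes`, namespace `Literature.AlgebraicGeometry.GroupSchemes`.
KERNEL ONLY: theorems; no definition, no named fact, no instance, no `sorry`.  Cell `hodgecm-mathlib`, road W, piece
(G0b)-F1 of the maximalisation step «a strict law extends to a strict law on its domain of definition»: the shears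
`Φ^max = (pr₁, mul^max)`, `Ψ^max = (mul^max, pr₂)` of the maximal law are open immersions because, on each of the
charts of ★ `BirationalGroupLaw.exists_chart_graphClosure` (where `mul^max (a, b) = x⁻¹((xa)b)` for a section `x`,
`λ = x·` the left translate, an open immersion), they are the composites of open immersions
`(λ × λ)⁻¹ ∘ Φ ∘ (λ × 𝟙)` and `(λ⁻¹ × 𝟙) ∘ Ψ ∘ (λ × 𝟙)` ([Artin1986NeronModels] §2, proof of Lemma 2.3 and (2.5);
[EdixhovenRomagny] Thm. 3.18).  This file isolates that computation for an ABSTRACT chart: an open `A ⊆ 𝒳` with an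
open immersion `λ : A → 𝒳` over `S`, the morphism `m₁ = (λ × 𝟙) : pr₁⁻¹ A → 𝒳 ×_S 𝒳` (given by its coordinates), and
a `T`-valued point `g₁` of `m₁⁻¹ dom` together with `g₂ : T → A` such that `λ ∘ g₂ = mul ∘ m₁ ∘ g₁` («`x·v = (xa)·b`»).

* `isPullback_translateProd` — `m₁ = λ × 𝟙` is the base change of `λ` along `pr₁`; `isOpenImmersion_translateProd`;
* `isOpenImmersion_chartShears` — `(pr₁ ∘ g₁, g₂)` and `(g₂, pr₂ ∘ g₁) : T → 𝒳 ×_S 𝒳` are open immersions when `g₁` is.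

## References
* [Artin1986NeronModels] M. Artin, *Néron models*, in *Arithmetic Geometry*, Springer 1986, §2, Lemma 2.3, (2.5).
* [EdixhovenRomagny] B. Edixhoven, M. Romagny, *Group schemes out of birational group laws*, Thm. 3.18, Lemma 3.19.
-/

set_option autoImplicit false

noncomputable section

open CategoryTheory CategoryTheory.Limits AlgebraicGeometry TopologicalSpace Topology MonoidalCategory
  CartesianMonoidalCategory

namespace Literature.AlgebraicGeometry.GroupSchemes

universe u

variable {S : Scheme.{u}} {𝒳 : Over S} (A : 𝒳.left.Opens) (lam : (A : Scheme.{u}) ⟶ 𝒳.left)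
  (hlamS : lam ≫ 𝒳.hom = A.ι ≫ 𝒳.hom)
  (m₁ : (((fst 𝒳 𝒳).left ⁻¹ᵁ A : (𝒳 ⊗ 𝒳).left.Opens) : Scheme.{u}) ⟶ (𝒳 ⊗ 𝒳).left)
  (hm₁1 : m₁ ≫ (fst 𝒳 𝒳).left = ((fst 𝒳 𝒳).left ∣_ A) ≫ lam)
  (hm₁2 : m₁ ≫ (snd 𝒳 𝒳).left = ((fst 𝒳 𝒳).left ⁻¹ᵁ A).ι ≫ (snd 𝒳 𝒳).left)

include hlamS hm₁1 hm₁2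

/-- **`λ × 𝟙` is the base change of `λ` along `pr₁`**: for an open `A ⊆ 𝒳`, a morphism `λ : A → 𝒳` over `S` and the
morphism `m₁ : pr₁⁻¹ A → 𝒳 ×_S 𝒳` with coordinates `(λ ∘ pr₁, pr₂)`, the square
`pr₁⁻¹ A —m₁→ 𝒳 ×_S 𝒳 —pr₁→ 𝒳 ← λ — A ← pr₁| — pr₁⁻¹ A` is cartesian.
[cite: Artin1986NeronModels, §2, proof of Lemma 2.3 (p. 222)] [cite: EdixhovenRomagny, Lemma 3.19] -/
theorem isPullback_translateProd : IsPullback ((fst 𝒳 𝒳).left ∣_ A) m₁ lam (fst 𝒳 𝒳).left := by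
  have hfstS : (fst 𝒳 𝒳).left ≫ 𝒳.hom = (𝒳 ⊗ 𝒳).hom := Over.w (fst 𝒳 𝒳)
  have hsndS : (snd 𝒳 𝒳).left ≫ 𝒳.hom = (𝒳 ⊗ 𝒳).hom := Over.w (snd 𝒳 𝒳)
  have hext : ∀ {T : Scheme.{u}} (f g : T ⟶ (𝒳 ⊗ 𝒳).left), f ≫ (fst 𝒳 𝒳).left = g ≫ (fst 𝒳 𝒳).left →
      f ≫ (snd 𝒳 𝒳).left = g ≫ (snd 𝒳 𝒳).left → f = g := fun f g h1 h2 => pullback.hom_ext h1 h2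
  have hres : ((fst 𝒳 𝒳).left ∣_ A) ≫ A.ι = ((fst 𝒳 𝒳).left ⁻¹ᵁ A).ι ≫ (fst 𝒳 𝒳).left := morphismRestrict_ι _ _
  have hsq : ((fst 𝒳 𝒳).left ∣_ A) ≫ lam = m₁ ≫ (fst 𝒳 𝒳).left := hm₁1.symm
  -- cone data: for `t = (a_t, p_t)` with `λ a_t = pr₁ p_t`, the point `q t = (a_t, pr₂ p_t)` of `pr₁⁻¹ A`
  have hq : ∀ t : PullbackCone lam (fst 𝒳 𝒳).left, ∃ q : t.pt ⟶ (𝒳 ⊗ 𝒳).left,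
      q ≫ (fst 𝒳 𝒳).left = t.fst ≫ A.ι ∧ q ≫ (snd 𝒳 𝒳).left = t.snd ≫ (snd 𝒳 𝒳).left := fun t => by
    have w : (t.fst ≫ A.ι) ≫ 𝒳.hom = (t.snd ≫ (snd 𝒳 𝒳).left) ≫ 𝒳.hom := by
      rw [Category.assoc, ← hlamS, ← Category.assoc, t.condition, Category.assoc, hfstS, Category.assoc, hsndS]
    exact ⟨pullback.lift (t.fst ≫ A.ι) (t.snd ≫ (snd 𝒳 𝒳).left) w, pullback.lift_fst _ _ _, pullback.lift_snd _ _ _⟩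
  choose q hq1 hq2 using hq
  have hrange : ∀ t : PullbackCone lam (fst 𝒳 𝒳).left,
      Set.range (q t).base ⊆ Set.range ((fst 𝒳 𝒳).left ⁻¹ᵁ A).ι.base := fun t => by
    rintro _ ⟨y, rfl⟩
    rw [Scheme.Opens.range_ι]
    change (q t ≫ (fst 𝒳 𝒳).left).base y ∈ A
    rw [hq1, Scheme.Hom.comp_apply, ← SetLike.mem_coe, ← Scheme.Opens.range_ι]
    exact ⟨_, rfl⟩
  have hl : ∀ t : PullbackCone lam (fst 𝒳 𝒳).left, ∃ l : t.pt ⟶ ↑((fst 𝒳 𝒳).left ⁻¹ᵁ A),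
      l ≫ ((fst 𝒳 𝒳).left ⁻¹ᵁ A).ι = q t := fun t =>
    ⟨IsOpenImmersion.lift _ (q t) (hrange t), IsOpenImmersion.lift_fac _ _ _⟩
  choose l hl using hl
  have hl1 : ∀ t : PullbackCone lam (fst 𝒳 𝒳).left, l t ≫ ((fst 𝒳 𝒳).left ∣_ A) = t.fst := fun t => by
    rw [← cancel_mono A.ι, Category.assoc, hres, reassoc_of% (hl t), hq1]
  refine IsPullback.of_isLimit' ⟨hsq⟩ (PullbackCone.IsLimit.mk hsq l hl1 (fun t => ?_) (fun t m hm₁ hm₂ => ?_))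
  · refine hext _ _ ?_ ?_
    · rw [Category.assoc, hm₁1, reassoc_of% (hl1 t), t.condition]
    · rw [Category.assoc, hm₁2, reassoc_of% (hl t), hq2]
  · rw [← cancel_mono ((fst 𝒳 𝒳).left ⁻¹ᵁ A).ι, hl]
    refine hext _ _ ?_ ?_
    · rw [Category.assoc, ← hres, reassoc_of% hm₁, hq1]
    · rw [Category.assoc, ← hm₁2, reassoc_of% hm₂, hq2]

/-- **`λ × 𝟙 : pr₁⁻¹ A → 𝒳 ×_S 𝒳` is an open immersion when `λ` is** (base change of `λ` along `pr₁`).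
[cite: Artin1986NeronModels, §2, proof of Lemma 2.3 (p. 222)] [cite: EdixhovenRomagny, Lemma 3.19] -/
theorem isOpenImmersion_translateProd [IsOpenImmersion lam] : IsOpenImmersion m₁ :=
  MorphismProperty.IsStableUnderBaseChange.of_isPullback (P := @IsOpenImmersion)
    (isPullback_translateProd A lam hlamS m₁ hm₁1 hm₁2) ‹_›

/-- **The shears of Artin's chart are open immersions** ([Artin1986NeronModels] §2, Lemma 2.3 / (2.5);
[EdixhovenRomagny] Thm. 3.18).  Let `L` be a birational group law on `𝒳`, `A ⊆ 𝒳` open with an open immersion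
`λ : A → 𝒳` over `S` (the left translate by a section), `m₁ = λ × 𝟙 : pr₁⁻¹ A → 𝒳 ×_S 𝒳`, and let `g₁ : T → m₁⁻¹ dom`
be an open immersion and `g₂ : T → A` with `λ ∘ g₂ = mul ∘ m₁ ∘ g₁` (on the chart: `g₂ = x⁻¹((xa)b)`).  Then the two
morphisms `(pr₁ ∘ g₁, g₂), (g₂, pr₂ ∘ g₁) : T → 𝒳 ×_S 𝒳` — the shears of the chart value — are OPEN IMMERSIONS: they are
`(λ × λ)⁻¹ ∘ Φ ∘ m₁ ∘ g₁` and `(λ × 𝟙)⁻¹ ∘ Ψ ∘ m₁ ∘ g₁`. [cite: Artin1986NeronModels, Lemma 2.3 and (2.5) (p. 222)]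
[cite: EdixhovenRomagny, Thm. 3.18] -/
theorem isOpenImmersion_chartShears (L : BirationalGroupLaw 𝒳) [IsOpenImmersion lam] {T : Scheme.{u}}
    (g₁ : T ⟶ ((m₁ ⁻¹ᵁ L.dom : (((fst 𝒳 𝒳).left ⁻¹ᵁ A : (𝒳 ⊗ 𝒳).left.Opens) : Scheme.{u}).Opens) : Scheme.{u}))
    [IsOpenImmersion g₁] (g₂ : T ⟶ (A : Scheme.{u})) (hg : g₂ ≫ lam = g₁ ≫ (m₁ ∣_ L.dom) ≫ L.mul)
    (wΦ : (g₁ ≫ (m₁ ⁻¹ᵁ L.dom).ι ≫ ((fst 𝒳 𝒳).left ⁻¹ᵁ A).ι ≫ (fst 𝒳 𝒳).left) ≫ 𝒳.hom = (g₂ ≫ A.ι) ≫ 𝒳.hom)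
    (wΨ : (g₂ ≫ A.ι) ≫ 𝒳.hom = (g₁ ≫ (m₁ ⁻¹ᵁ L.dom).ι ≫ ((fst 𝒳 𝒳).left ⁻¹ᵁ A).ι ≫ (snd 𝒳 𝒳).left) ≫ 𝒳.hom) :
    IsOpenImmersion (pullback.lift (g₁ ≫ (m₁ ⁻¹ᵁ L.dom).ι ≫ ((fst 𝒳 𝒳).left ⁻¹ᵁ A).ι ≫ (fst 𝒳 𝒳).left)
        (g₂ ≫ A.ι) wΦ : T ⟶ (𝒳 ⊗ 𝒳).left) ∧
      IsOpenImmersion (pullback.lift (g₂ ≫ A.ι)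
        (g₁ ≫ (m₁ ⁻¹ᵁ L.dom).ι ≫ ((fst 𝒳 𝒳).left ⁻¹ᵁ A).ι ≫ (snd 𝒳 𝒳).left) wΨ : T ⟶ (𝒳 ⊗ 𝒳).left) := by
  haveI hm₁o : IsOpenImmersion m₁ := isOpenImmersion_translateProd A lam hlamS m₁ hm₁1 hm₁2
  have hext : ∀ {T : Scheme.{u}} (f g : T ⟶ (𝒳 ⊗ 𝒳).left), f ≫ (fst 𝒳 𝒳).left = g ≫ (fst 𝒳 𝒳).left →
      f ≫ (snd 𝒳 𝒳).left = g ≫ (snd 𝒳 𝒳).left → f = g := fun f g h1 h2 => pullback.hom_ext h1 h2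
  have hres₁ : ((fst 𝒳 𝒳).left ∣_ A) ≫ A.ι = ((fst 𝒳 𝒳).left ⁻¹ᵁ A).ι ≫ (fst 𝒳 𝒳).left := morphismRestrict_ι _ _
  have hres₂ : (m₁ ∣_ L.dom) ≫ L.dom.ι = (m₁ ⁻¹ᵁ L.dom).ι ≫ m₁ := morphismRestrict_ι _ _
  -- the shears of `L`, retyped on `↑dom`
  let Φ' : (L.dom : Scheme.{u}) ⟶ (𝒳 ⊗ 𝒳).left := L.shearLeft.left
  haveI : IsOpenImmersion Φ' := L.isOpenImmersion_shearLeft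
  have hΦ1 : Φ' ≫ (fst 𝒳 𝒳).left = L.dom.ι ≫ (fst 𝒳 𝒳).left :=
    congrArg CommaMorphism.left (LawData.shearLeft_fst 𝒳 L.dom L.mul L.mul_comp)
  have hΦ2 : Φ' ≫ (snd 𝒳 𝒳).left = L.mul :=
    congrArg CommaMorphism.left (LawData.shearLeft_snd 𝒳 L.dom L.mul L.mul_comp)
  let Ψ' : (L.dom : Scheme.{u}) ⟶ (𝒳 ⊗ 𝒳).left := L.shearRight.left
  haveI : IsOpenImmersion Ψ' := L.isOpenImmersion_shearRight
  have hΨ1 : Ψ' ≫ (fst 𝒳 𝒳).left = L.mul :=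
    congrArg CommaMorphism.left (LawData.shearRight_fst 𝒳 L.dom L.mul L.mul_comp)
  have hΨ2 : Ψ' ≫ (snd 𝒳 𝒳).left = L.dom.ι ≫ (snd 𝒳 𝒳).left :=
    congrArg CommaMorphism.left (LawData.shearRight_snd 𝒳 L.dom L.mul L.mul_comp)
  -- the symmetry `β : (a, b) ↦ (b, a)` of `𝒳 ×_S 𝒳`
  let β : (𝒳 ⊗ 𝒳).left ≅ (𝒳 ⊗ 𝒳).left := pullbackSymmetry 𝒳.hom 𝒳.hom
  have hβ1 : β.hom ≫ (fst 𝒳 𝒳).left = (snd 𝒳 𝒳).left := pullbackSymmetry_hom_comp_fst _ _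
  have hβ2 : β.hom ≫ (snd 𝒳 𝒳).left = (fst 𝒳 𝒳).left := pullbackSymmetry_hom_comp_snd _ _
  -- a `T`-point `q` of `𝒳 ×_S 𝒳` with `pr₁ q = ι r`, `r : T → A`, lifts to `s : T → pr₁⁻¹ A`, and
  -- `s ≫ m₁ = (λ r, pr₂ q)`
  have hlift : ∀ (q : T ⟶ (𝒳 ⊗ 𝒳).left) (r : T ⟶ (A : Scheme.{u})), q ≫ (fst 𝒳 𝒳).left = r ≫ A.ι →
      ∃ s : T ⟶ ↑((fst 𝒳 𝒳).left ⁻¹ᵁ A), s ≫ ((fst 𝒳 𝒳).left ⁻¹ᵁ A).ι = q ∧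
        s ≫ m₁ ≫ (fst 𝒳 𝒳).left = r ≫ lam ∧ s ≫ m₁ ≫ (snd 𝒳 𝒳).left = q ≫ (snd 𝒳 𝒳).left := by
    intro q r h
    have hr : Set.range q.base ⊆ Set.range ((fst 𝒳 𝒳).left ⁻¹ᵁ A).ι.base := by
      rintro _ ⟨y, rfl⟩
      rw [Scheme.Opens.range_ι]
      change (q ≫ (fst 𝒳 𝒳).left).base y ∈ A
      rw [h, Scheme.Hom.comp_apply, ← SetLike.mem_coe, ← Scheme.Opens.range_ι]
      exact ⟨_, rfl⟩
    have hs : IsOpenImmersion.lift _ q hr ≫ ((fst 𝒳 𝒳).left ⁻¹ᵁ A).ι = q := IsOpenImmersion.lift_fac _ _ _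
    have hsr : IsOpenImmersion.lift _ q hr ≫ ((fst 𝒳 𝒳).left ∣_ A) = r := by
      rw [← cancel_mono A.ι, Category.assoc, hres₁, reassoc_of% hs, h]
    exact ⟨_, hs, by rw [hm₁1, reassoc_of% hsr], by rw [hm₁2, reassoc_of% hs]⟩
  -- the first coordinate `a = pr₁ (g₁)` factors through `A`
  have ha : g₁ ≫ (m₁ ⁻¹ᵁ L.dom).ι ≫ ((fst 𝒳 𝒳).left ⁻¹ᵁ A).ι ≫ (fst 𝒳 𝒳).left =
      (g₁ ≫ (m₁ ⁻¹ᵁ L.dom).ι ≫ ((fst 𝒳 𝒳).left ∣_ A)) ≫ A.ι := by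
    simp only [Category.assoc, hres₁]
  constructor
  · -- `Φ`-shear `(a, v)`: with `s₁ = (v, a)`, `t₁ = m₁ s₁ = (λ v, a)`, `s₂ = (a, λ v)`, `m₁ s₂ = (λ a, λ v) = Φ (m₁ g₁)`
    set Φ₃ : T ⟶ (𝒳 ⊗ 𝒳).left := pullback.lift (g₁ ≫ (m₁ ⁻¹ᵁ L.dom).ι ≫ ((fst 𝒳 𝒳).left ⁻¹ᵁ A).ι ≫
      (fst 𝒳 𝒳).left) (g₂ ≫ A.ι) wΦ with hΦ₃
    have hΦ₃1 : Φ₃ ≫ (fst 𝒳 𝒳).left = g₁ ≫ (m₁ ⁻¹ᵁ L.dom).ι ≫ ((fst 𝒳 𝒳).left ⁻¹ᵁ A).ι ≫ (fst 𝒳 𝒳).left :=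
      pullback.lift_fst _ _ _
    have hΦ₃2 : Φ₃ ≫ (snd 𝒳 𝒳).left = g₂ ≫ A.ι := pullback.lift_snd _ _ _
    have h₁ : (Φ₃ ≫ β.hom) ≫ (fst 𝒳 𝒳).left = g₂ ≫ A.ι := by rw [Category.assoc, hβ1, hΦ₃2]
    obtain ⟨s₁, hs₁, ht₁1, ht₁2⟩ := hlift (Φ₃ ≫ β.hom) g₂ h₁
    have ht₁2' : s₁ ≫ m₁ ≫ (snd 𝒳 𝒳).left =
        (g₁ ≫ (m₁ ⁻¹ᵁ L.dom).ι ≫ ((fst 𝒳 𝒳).left ∣_ A)) ≫ A.ι := by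
      rw [ht₁2, Category.assoc, hβ2, hΦ₃1, ha]
    have h₂ : ((s₁ ≫ m₁) ≫ β.hom) ≫ (fst 𝒳 𝒳).left = (g₁ ≫ (m₁ ⁻¹ᵁ L.dom).ι ≫ ((fst 𝒳 𝒳).left ∣_ A)) ≫ A.ι := by
      rw [Category.assoc, hβ1, Category.assoc, ht₁2']
    obtain ⟨s₂, hs₂, ht₂1, ht₂2⟩ := hlift ((s₁ ≫ m₁) ≫ β.hom) _ h₂
    have ht₂ : s₂ ≫ m₁ = g₁ ≫ (m₁ ∣_ L.dom) ≫ Φ' := by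
      refine hext _ _ ?_ ?_
      · simp only [Category.assoc]
        rw [ht₂1, hΦ1, reassoc_of% hres₂, hm₁1]
        simp only [Category.assoc]
      · simp only [Category.assoc]
        rw [ht₂2, Category.assoc, Category.assoc, hβ2, ht₁1, hΦ2, hg]
    haveI : IsOpenImmersion (s₂ ≫ m₁) := by rw [ht₂]; infer_instance
    haveI : IsOpenImmersion s₂ := IsOpenImmersion.of_comp _ m₁
    haveI : IsOpenImmersion ((s₁ ≫ m₁) ≫ β.hom) := by rw [← hs₂]; infer_instance
    haveI : IsOpenImmersion (s₁ ≫ m₁) := by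
      rw [show s₁ ≫ m₁ = ((s₁ ≫ m₁) ≫ β.hom) ≫ β.inv by rw [Category.assoc, Iso.hom_inv_id, Category.comp_id]]
      infer_instance
    haveI : IsOpenImmersion s₁ := IsOpenImmersion.of_comp _ m₁
    haveI : IsOpenImmersion (Φ₃ ≫ β.hom) := by rw [← hs₁]; infer_instance
    -- (the goal's codomain is syntactically `pullback 𝒳.hom 𝒳.hom`: close by `exact`, not instance search)
    have hfin : IsOpenImmersion ((Φ₃ ≫ β.hom) ≫ β.inv) := inferInstance
    rw [show Φ₃ = (Φ₃ ≫ β.hom) ≫ β.inv by rw [Category.assoc, Iso.hom_inv_id, Category.comp_id]]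
    exact hfin
  · -- `Ψ`-shear `(v, b)`: with `s = (v, b)`, `m₁ s = (λ v, b) = Ψ (m₁ g₁)`
    set Ψ₃ : T ⟶ (𝒳 ⊗ 𝒳).left := pullback.lift (g₂ ≫ A.ι) (g₁ ≫ (m₁ ⁻¹ᵁ L.dom).ι ≫
      ((fst 𝒳 𝒳).left ⁻¹ᵁ A).ι ≫ (snd 𝒳 𝒳).left) wΨ with hΨ₃
    have hΨ₃1 : Ψ₃ ≫ (fst 𝒳 𝒳).left = g₂ ≫ A.ι := pullback.lift_fst _ _ _
    have hΨ₃2 : Ψ₃ ≫ (snd 𝒳 𝒳).left = g₁ ≫ (m₁ ⁻¹ᵁ L.dom).ι ≫ ((fst 𝒳 𝒳).left ⁻¹ᵁ A).ι ≫ (snd 𝒳 𝒳).left :=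
      pullback.lift_snd _ _ _
    obtain ⟨s, hs, ht1, ht2⟩ := hlift Ψ₃ g₂ hΨ₃1
    have ht : s ≫ m₁ = g₁ ≫ (m₁ ∣_ L.dom) ≫ Ψ' := by
      refine hext _ _ ?_ ?_
      · simp only [Category.assoc]
        rw [ht1, hΨ1, hg]
      · simp only [Category.assoc]
        rw [ht2, hΨ₃2, hΨ2, reassoc_of% hres₂, hm₁2]
    haveI : IsOpenImmersion (s ≫ m₁) := by rw [ht]; infer_instance
    haveI : IsOpenImmersion s := IsOpenImmersion.of_comp _ m₁
    have hfin : IsOpenImmersion (s ≫ ((fst 𝒳 𝒳).left ⁻¹ᵁ A).ι) := inferInstance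
    rw [← hs]; exact hfin

end Literature.AlgebraicGeometry.GroupSchemes

end
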